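import Literature.Barriers.AtomisticToContinuum.DisorderedHarmonicChainCovariance
import Literature.MathematicalPhysics.KineticTheory.LinearLangevinGaussian
import HarnessLib

/-!
# The Casher–Lebowitz generator against a Gaussian density (integration by parts)

Companion to `DisorderedHarmonicChainSpectral.lean` (barrier catalogue
`Literature/Barriers/AtomisticToContinuum/`, sub-problem `FouriersLaw`; provefact unit of
`AjankiHuveneers2011_scaling`, bottom-up step towards the named fact
`CasherLebowitz1971_steadyState` = (F1a), the Gaussian stationary state). This is the
Casher–Lebowitz analogue of `LinearLangevinGaussian.lean` (which treats the unit-mass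
`OscillatorChain.generator`): for the generator `clGenerator m λ T_L T_R`
(`DisorderedHarmonicChain.lean`: `dq_k = (p_k/m_k) dt`,
`dp_k = -(Φ_D q)_k dt + [k end](-λ p_k dt + √(2λT_k m_k) dW_k)`) and ANY symmetric matrix `B` on
the flat phase-space coordinates `x♭ = (q, p)`, we compute `∫ (L f) ρ_B`, `ρ_B = e^{-x♭ᵀBx♭/2}`,
by two integrations by parts per site (the wrappers of `LangevinChainGibbs.lean` /
`LinearLangevinGaussian.lean`), all PROVED:

* `clHamiltonian_eq` (kinetic part `∑ p_k²/(2m_k)` plus `½ x♭ᵀ B_Φ x♭` with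
  `B_Φ = clPotentialMatrix = [[Φ_D, 0], [0, 0]]`), `contDiff_clHamiltonian`,
  `partialQ_clHamiltonian : ∂_{q_k} H = (Φ_D q)_k`;
* `cl_integral_liouville_mul_gaussDensity`:
  `∫ ((p_i/m_i) ∂_{q_i} f - (Φ_D q)_i ∂_{p_i} f) ρ_B = ∫ ((p_i/m_i)(Bx♭)_{q_i} - (Φ_D q)_i (Bx♭)_{p_i}) ρ_B f`;
* `clAdjointPoly` (the formal adjoint applied to `ρ_B`, divided by `ρ_B`) and
  `cl_integral_generator_mul_gaussDensity : ∫ (clGenerator m λ T_L T_R f) ρ_B = ∫ (L*_B) ρ_B f`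
  for `f ∈ C²_c` (the bath terms are `integral_bath_mul_gaussDensity` of the tree with
  `T_b = T m_k`).

So `ρ_B dq dp` is weakly stationary for the Casher–Lebowitz chain iff `∫ (L*_B) ρ_B f = 0` for all
test functions; for `B⁻¹ = clCov` (the Lyapunov solution) `L*_B ≡ 0`, which is the matrix
identity of the next file of the unit.

## References

Dhar 2008, §3.1 (Gaussian stationary state of the general harmonic network with Langevin baths,
arbitrary masses); Cuneo–Eckmann–Hairer–Rey-Bellet 2018, §3.1 (invariance is `L* ρ = 0`);
Ajanki–Huveneers 2011, §1.1 eq. (1.3)–(1.4) (the model).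
-/

noncomputable section

open MeasureTheory Matrix
open scoped ContDiff

namespace Literature.Barriers.AtomisticToContinuum.HeatConduction

open Literature.MathematicalPhysics.KineticTheory.HeatConduction

variable {n : ℕ}

/-! ### The Hamiltonian: kinetic part plus `½ x♭ᵀ B_Φ x♭`; `∂_{q_k} H = (Φ_D q)_k` -/

/-- The potential-energy matrix on the flat coordinates: `B_Φ = [[Φ_D, 0], [0, 0]]`, so that the
potential energy of the Casher–Lebowitz chain is `½ x♭ᵀ B_Φ x♭ = ½ qᵀ Φ_D q`. [folklore] -/
def clPotentialMatrix (n : ℕ) : Matrix (Fin n ⊕ Fin n) (Fin n ⊕ Fin n) ℝ :=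
  Matrix.fromBlocks (clForceMatrix n) 0 0 0

/-- `B_Φ` is symmetric. [folklore] -/
theorem clPotentialMatrix_transpose (n : ℕ) : (clPotentialMatrix n)ᵀ = clPotentialMatrix n := by
  rw [clPotentialMatrix, fromBlocks_transpose, transpose_zero, clForceMatrix_transpose]

/-- `(B_Φ x♭)_{q_i} = (Φ_D q)_i`. [folklore] -/
theorem clPotentialMatrix_mulVec_flat_inl (x : PhaseSpace n) (i : Fin n) :
    (clPotentialMatrix n *ᵥ flat x) (Sum.inl i) = (clForceMatrix n *ᵥ x.1) i := by
  have h : flat x = Sum.elim x.1 x.2 := rfl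
  rw [clPotentialMatrix, h, fromBlocks_mulVec]
  simp

/-- `(B_Φ x♭)_{p_i} = 0`. [folklore] -/
theorem clPotentialMatrix_mulVec_flat_inr (x : PhaseSpace n) (i : Fin n) :
    (clPotentialMatrix n *ᵥ flat x) (Sum.inr i) = 0 := by
  have h : flat x = Sum.elim x.1 x.2 := rfl
  rw [clPotentialMatrix, h, fromBlocks_mulVec]
  simp

/-- `x♭ᵀ B_Φ x♭ = qᵀ Φ_D q`. [folklore] -/
theorem quadForm_clPotentialMatrix (x : PhaseSpace n) :
    quadForm (clPotentialMatrix n) x = x.1 ⬝ᵥ (clForceMatrix n *ᵥ x.1) := by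
  have h : flat x = Sum.elim x.1 x.2 := rfl
  rw [quadForm, clPotentialMatrix, h, fromBlocks_mulVec, sumElim_dotProduct_sumElim]
  simp

/-- **The Casher–Lebowitz Hamiltonian is `∑ p_k²/(2m_k) + ½ qᵀ Φ_D q`.** [folklore] -/
theorem clHamiltonian_eq (m : Fin n → ℝ) (x : PhaseSpace n) :
    clHamiltonian m x = (∑ k, x.2 k ^ 2 / (2 * m k)) + quadForm (clPotentialMatrix n) x / 2 := by
  rw [quadForm_clPotentialMatrix, dotProduct_clForceMatrix_mulVec, clHamiltonian]
  congr 2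
  have hw : ∑ i, (bathMult n i : ℝ) * x.1 i ^ 2 =
      (∑ k : Fin n, if k.val = 0 then x.1 k ^ 2 else 0) +
        ∑ k : Fin n, if k.val = n - 1 then x.1 k ^ 2 else 0 := by
    rw [← Finset.sum_add_distrib]
    refine Finset.sum_congr rfl fun i _ => ?_
    simp only [bathMult]
    split_ifs <;> ring
  rw [hw, add_assoc]

/-- The Hamiltonian is smooth (a polynomial). [folklore] -/
theorem contDiff_clHamiltonian (m : Fin n → ℝ) {N : WithTop ℕ∞} :
    ContDiff ℝ N (clHamiltonian m : PhaseSpace n → ℝ) := by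
  have hq : ∀ i : Fin n, ContDiff ℝ N fun x : PhaseSpace n => x.1 i := fun i =>
    (contDiff_apply ℝ ℝ i).comp contDiff_fst
  have hp : ∀ i : Fin n, ContDiff ℝ N fun x : PhaseSpace n => x.2 i := fun i =>
    (contDiff_apply ℝ ℝ i).comp contDiff_snd
  unfold clHamiltonian
  refine (ContDiff.sum fun k _ => ((hp k).pow 2).div_const _).add (ContDiff.div_const ?_ _)
  refine ((ContDiff.sum fun k _ => ContDiff.sum fun j _ => ?_).add
    (ContDiff.sum fun k _ => ?_)).add (ContDiff.sum fun k _ => ?_)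
  · split_ifs
    · exact ((hq j).sub (hq k)).pow 2
    · exact contDiff_const
  · split_ifs
    · exact (hq k).pow 2
    · exact contDiff_const
  · split_ifs
    · exact (hq k).pow 2
    · exact contDiff_const

/-- The kinetic energy does not change along a position direction. [folklore] -/
theorem kinetic_add_smul_unitQ (m : Fin n → ℝ) (x : PhaseSpace n) (t : ℝ) (i : Fin n) :
    (∑ k, (x + t • ((Pi.single i 1, 0) : PhaseSpace n)).2 k ^ 2 / (2 * m k)) =
      ∑ k, x.2 k ^ 2 / (2 * m k) := by
  rw [add_smul_unitQ_snd]

/-- **`∂_{q_i} H = (Φ_D q)_i`** as a line derivative along `(e_i, 0)`. [folklore] -/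
theorem hasLineDerivAt_clHamiltonian_unitQ (m : Fin n → ℝ) (x : PhaseSpace n) (i : Fin n) :
    HasLineDerivAt ℝ (clHamiltonian m : PhaseSpace n → ℝ) ((clForceMatrix n *ᵥ x.1) i) x
      ((Pi.single i 1, 0) : PhaseSpace n) := by
  have hfun : (clHamiltonian m : PhaseSpace n → ℝ) =
      fun y => (∑ k, y.2 k ^ 2 / (2 * m k)) + quadForm (clPotentialMatrix n) y / 2 := by
    funext y
    exact clHamiltonian_eq m y
  rw [hfun]
  have h1 : HasLineDerivAt ℝ (fun y : PhaseSpace n => ∑ k, y.2 k ^ 2 / (2 * m k)) 0 x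
      ((Pi.single i 1, 0) : PhaseSpace n) := by
    unfold HasLineDerivAt
    simp_rw [kinetic_add_smul_unitQ]
    exact hasDerivAt_const _ _
  have h2 := ((hasLineDerivAt_quadForm (clPotentialMatrix n) (clPotentialMatrix_transpose n) x
    ((Pi.single i 1, 0) : PhaseSpace n))).div_const 2
  refine (h1.add h2).congr_deriv ?_
  have hflat : flat ((Pi.single i 1, 0) : PhaseSpace n) = Pi.single (Sum.inl i) 1 :=
    flat_coordVec (Sum.inl i)
  rw [hflat, single_dotProduct, one_mul, clPotentialMatrix_mulVec_flat_inl]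
  ring

/-- **`∂_{q_i} H = (Φ_D q)_i`** for the coordinate derivative of `FouriersLaw.lean`. [folklore] -/
theorem partialQ_clHamiltonian (m : Fin n → ℝ) (x : PhaseSpace n) (i : Fin n) :
    partialQ i (clHamiltonian m) x = (clForceMatrix n *ᵥ x.1) i := by
  rw [partialQ_eq_lineDeriv]
  exact (hasLineDerivAt_clHamiltonian_unitQ m x i).lineDeriv

/-- `x ↦ (Φ_D q)_i` is continuous. [folklore] -/
theorem continuous_clForce_apply (i : Fin n) :
    Continuous fun x : PhaseSpace n => (clForceMatrix n *ᵥ x.1) i := by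
  show Continuous fun x : PhaseSpace n => ∑ j, (clForceMatrix n : Matrix (Fin n) (Fin n) ℝ) i j * x.1 j
  exact continuous_finsetSum _ fun j _ =>
    continuous_const.mul ((continuous_apply j).comp continuous_fst)

/-! ### Integration by parts against `ρ_B` -/

variable (B : Matrix (Fin n ⊕ Fin n) (Fin n ⊕ Fin n) ℝ)

/-- **Liouville part of the Casher–Lebowitz generator against a Gaussian density.** For
`f ∈ C¹_c`, a symmetric `B` and every site `i`,
`∫ ((p_i/m_i) ∂_{q_i} f - (Φ_D q)_i ∂_{p_i} f) ρ_B = ∫ ((p_i/m_i)(Bx♭)_{q_i} - (Φ_D q)_i (Bx♭)_{p_i}) ρ_B f`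
(two integrations by parts; `p_i/m_i` is constant along `(e_i,0)` and `(Φ_D q)_i` along
`(0,e_i)`). [folklore] -/
theorem cl_integral_liouville_mul_gaussDensity (hB : Bᵀ = B) (m : Fin n → ℝ)
    {f : PhaseSpace n → ℝ} (hf : ContDiff ℝ 1 f) (hfc : HasCompactSupport f) (i : Fin n) :
    ∫ x, (x.2 i / m i * partialQ i f x - (clForceMatrix n *ᵥ x.1) i * partialP i f x) *
      gaussDensity B x =
    ∫ x, (x.2 i / m i * (B *ᵥ flat x) (Sum.inl i) -
      (clForceMatrix n *ᵥ x.1) i * (B *ᵥ flat x) (Sum.inr i)) * gaussDensity B x * f x := by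
  have hfd : Differentiable ℝ f := hf.differentiable one_ne_zero
  have hρc : Continuous (gaussDensity B : PhaseSpace n → ℝ) := continuous_gaussDensity B
  have hWc : Continuous fun x : PhaseSpace n => (clForceMatrix n *ᵥ x.1) i :=
    continuous_clForce_apply i
  have hQc : Continuous (partialQ i f) := continuous_partialQ hf one_ne_zero i
  have hPc : Continuous (partialP i f) := continuous_partialP hf one_ne_zero i
  have hBq : Continuous fun x : PhaseSpace n => (B *ᵥ flat x) (Sum.inl i) :=
    continuous_mulVec_flat_apply B _
  have hBp : Continuous fun x : PhaseSpace n => (B *ᵥ flat x) (Sum.inr i) :=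
    continuous_mulVec_flat_apply B _
  have hp2 : Continuous fun x : PhaseSpace n => x.2 i / m i :=
    ((continuous_apply i).comp continuous_snd).div_const _
  have e1 : ∫ x, (x.2 i / m i * gaussDensity B x) * partialQ i f x =
      -∫ x, (x.2 i / m i * (-((B *ᵥ flat x) (Sum.inl i)) * gaussDensity B x)) * f x := by
    apply integral_mul_eq_neg_of_hasLineDerivAt (v := ((Pi.single i 1, 0) : PhaseSpace n))
    · exact hp2.mul hρc
    · exact hp2.mul (hBq.neg.mul hρc)
    · exact hf.continuous
    · exact hQc
    · exact hfc
    · exact hasCompactSupport_partialQ hfd hfc i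
    · intro x
      have hρ' := hasLineDerivAt_gaussDensity_unitQ B hB x i
      unfold HasLineDerivAt at hρ' ⊢
      simp only [add_smul_unitQ_snd]
      exact hρ'.const_mul (x.2 i / m i)
    · exact fun x => hasLineDerivAt_partialQ hfd i x
  have e2 : ∫ x, ((clForceMatrix n *ᵥ x.1) i * gaussDensity B x) * partialP i f x =
      -∫ x, ((clForceMatrix n *ᵥ x.1) i * (-((B *ᵥ flat x) (Sum.inr i)) * gaussDensity B x)) *
        f x := by
    apply integral_mul_eq_neg_of_hasLineDerivAt (v := ((0, Pi.single i 1) : PhaseSpace n))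
    · exact hWc.mul hρc
    · exact hWc.mul (hBp.neg.mul hρc)
    · exact hf.continuous
    · exact hPc
    · exact hfc
    · exact hasCompactSupport_partialP hfd hfc i
    · intro x
      have hρ' := hasLineDerivAt_gaussDensity_unitP B hB x i
      unfold HasLineDerivAt at hρ' ⊢
      simp only [add_smul_unitP_fst]
      exact hρ'.const_mul _
    · exact fun x => hasLineDerivAt_partialP hfd i x
  have hsplit : (fun x => (x.2 i / m i * partialQ i f x -
      (clForceMatrix n *ᵥ x.1) i * partialP i f x) * gaussDensity B x) =
      fun x => (x.2 i / m i * gaussDensity B x) * partialQ i f x -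
        ((clForceMatrix n *ᵥ x.1) i * gaussDensity B x) * partialP i f x := by
    funext x; ring
  rw [hsplit, integral_sub, e1, e2, ← integral_neg, ← integral_neg, ← integral_sub]
  · refine integral_congr_ae (Filter.Eventually.of_forall fun x => ?_)
    simp only
    ring
  · exact ((hp2.mul (hBq.neg.mul hρc)).mul
      hf.continuous).neg.integrable_of_hasCompactSupport hfc.mul_left.neg
  · exact ((hWc.mul (hBp.neg.mul hρc)).mul hf.continuous).neg.integrable_of_hasCompactSupport
      hfc.mul_left.neg
  · exact ((hp2.mul hρc).mul
      hQc).integrable_of_hasCompactSupport (hasCompactSupport_partialQ hfd hfc i).mul_left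
  · exact ((hWc.mul hρc).mul hPc).integrable_of_hasCompactSupport
      (hasCompactSupport_partialP hfd hfc i).mul_left

/-- The polynomial `L*_B := ρ_B⁻¹ L* ρ_B` obtained by applying the formal adjoint of the
Casher–Lebowitz generator `clGenerator m λ T_L T_R` to the Gaussian density `ρ_B`:
`∑_i ((p_i/m_i)(Bx♭)_{q_i} - (Φ_D q)_i (Bx♭)_{p_i})
  + λ ∑_i ([i=0]((1 - p_i (Bx♭)_{p_i}) - T_L m_i (B_{p_ip_i} - (Bx♭)²_{p_i})) + [i=n-1](… T_R m_i …))`.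
[folklore] -/
def clAdjointPoly (m : Fin n → ℝ) (lam T_L T_R : ℝ) (x : PhaseSpace n) : ℝ :=
  (∑ i : Fin n, (x.2 i / m i * (B *ᵥ flat x) (Sum.inl i) -
    (clForceMatrix n *ᵥ x.1) i * (B *ᵥ flat x) (Sum.inr i))) +
  lam * ∑ i : Fin n,
    ((if i.val = 0 then (1 - x.2 i * (B *ᵥ flat x) (Sum.inr i)) -
        T_L * m i * (B (Sum.inr i) (Sum.inr i) - ((B *ᵥ flat x) (Sum.inr i)) ^ 2) else 0) +
      (if i.val = n - 1 then (1 - x.2 i * (B *ᵥ flat x) (Sum.inr i)) -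
        T_R * m i * (B (Sum.inr i) (Sum.inr i) - ((B *ᵥ flat x) (Sum.inr i)) ^ 2) else 0))

/-- The adjoint polynomial is continuous. [folklore] -/
theorem continuous_clAdjointPoly (m : Fin n → ℝ) (lam T_L T_R : ℝ) :
    Continuous (clAdjointPoly B m lam T_L T_R) := by
  have hWc : ∀ i, Continuous fun x : PhaseSpace n => (clForceMatrix n *ᵥ x.1) i :=
    fun i => continuous_clForce_apply i
  have hBc : ∀ a, Continuous fun x : PhaseSpace n => (B *ᵥ flat x) a :=
    fun a => continuous_mulVec_flat_apply B a
  have hp : ∀ i : Fin n, Continuous fun x : PhaseSpace n => x.2 i := fun i =>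
    (continuous_apply i).comp continuous_snd
  unfold clAdjointPoly
  refine (continuous_finsetSum _ fun i _ => ?_).add
    (continuous_const.mul (continuous_finsetSum _ fun i _ => ?_))
  · exact (((hp i).div_const _).mul (hBc _)).sub ((hWc i).mul (hBc _))
  · refine Continuous.add ?_ ?_ <;> split_ifs
    · exact (continuous_const.sub ((hp i).mul (hBc _))).sub
        (continuous_const.mul (continuous_const.sub ((hBc _).pow 2)))
    · exact continuous_const
    · exact (continuous_const.sub ((hp i).mul (hBc _))).sub
        (continuous_const.mul (continuous_const.sub ((hBc _).pow 2)))
    · exact continuous_const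

/-- **The Casher–Lebowitz generator against a Gaussian density.** For `f ∈ C²_c`, symmetric `B`
and any masses, friction and bath temperatures, `∫ (L f) ρ_B = ∫ (L*_B) ρ_B f` with
`L = clGenerator m λ T_L T_R` and the explicit quadratic polynomial `L*_B = clAdjointPoly`: the
measure `ρ_B dq dp` is weakly stationary iff `∫ (L*_B) ρ_B f = 0` for all test functions, e.g. if
`L*_B ≡ 0`. [cite: Dhar2008, §3.1] -/
theorem cl_integral_generator_mul_gaussDensity (hB : Bᵀ = B) (m : Fin n → ℝ)
    (lam T_L T_R : ℝ) {f : PhaseSpace n → ℝ} (hf : ContDiff ℝ 2 f) (hfc : HasCompactSupport f) :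
    ∫ x, clGenerator m lam T_L T_R f x * gaussDensity B x =
      ∫ x, clAdjointPoly B m lam T_L T_R x * gaussDensity B x * f x := by
  have hf1 : ContDiff ℝ 1 f := hf.of_le (by norm_num)
  have hfd : Differentiable ℝ f := hf.differentiable two_ne_zero
  have hρc : Continuous (gaussDensity B : PhaseSpace n → ℝ) := continuous_gaussDensity B
  have hBc : ∀ a, Continuous fun x : PhaseSpace n => (B *ᵥ flat x) a :=
    fun a => continuous_mulVec_flat_apply B a
  -- regularity of the pieces
  have hQc : ∀ i, Continuous (partialQ i f) := fun i => continuous_partialQ hf1 one_ne_zero i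
  have hPc : ∀ i, Continuous (partialP i f) := fun i => continuous_partialP hf1 one_ne_zero i
  have hP1 : ∀ i, ContDiff ℝ 1 (partialP i f) := fun i => contDiff_partialP hf (by norm_num) i
  have hPPc : ∀ i, Continuous (partialP i (partialP i f)) := fun i =>
    continuous_partialP (hP1 i) one_ne_zero i
  have hQs : ∀ i, HasCompactSupport (partialQ i f) := fun i => hasCompactSupport_partialQ hfd hfc i
  have hPs : ∀ i, HasCompactSupport (partialP i f) := fun i => hasCompactSupport_partialP hfd hfc i
  have hPPs : ∀ i, HasCompactSupport (partialP i (partialP i f)) := fun i =>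
    hasCompactSupport_partialP ((hP1 i).differentiable one_ne_zero) (hPs i) i
  have hWc : ∀ i, Continuous fun x : PhaseSpace n => (clForceMatrix n *ᵥ x.1) i :=
    fun i => continuous_clForce_apply i
  have hpm : ∀ i : Fin n, Continuous fun x : PhaseSpace n => x.2 i / m i := fun i =>
    ((continuous_apply i).comp continuous_snd).div_const _
  have hp2 : ∀ i : Fin n, Continuous fun x : PhaseSpace n => x.2 i := fun i =>
    (continuous_apply i).comp continuous_snd
  -- the generator with `∂_{q_i}H` made explicit
  have hgen : ∀ x, clGenerator m lam T_L T_R f x =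
      (∑ i : Fin n, (x.2 i / m i * partialQ i f x - (clForceMatrix n *ᵥ x.1) i * partialP i f x)) +
      lam * ∑ i : Fin n,
        ((if i.val = 0 then T_L * m i * partialP i (partialP i f) x - x.2 i * partialP i f x
          else 0) +
          (if i.val = n - 1 then T_R * m i * partialP i (partialP i f) x - x.2 i * partialP i f x
            else 0)) := by
    intro x
    simp only [clGenerator, partialQ_clHamiltonian]
  -- the right-hand side integrands
  set liou : Fin n → PhaseSpace n → ℝ := fun i x => (x.2 i / m i * (B *ᵥ flat x) (Sum.inl i) -
    (clForceMatrix n *ᵥ x.1) i * (B *ᵥ flat x) (Sum.inr i)) with hliou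
  set bath : ℝ → Fin n → PhaseSpace n → ℝ := fun Tb i x => (1 - x.2 i * (B *ᵥ flat x) (Sum.inr i)) -
    Tb * (B (Sum.inr i) (Sum.inr i) - ((B *ᵥ flat x) (Sum.inr i)) ^ 2) with hbath
  have hliou_c : ∀ i, Continuous (liou i) := fun i =>
    ((hpm i).mul (hBc _)).sub ((hWc i).mul (hBc _))
  have hbath_c : ∀ Tb i, Continuous (bath Tb i) := fun Tb i =>
    (continuous_const.sub ((hp2 i).mul (hBc _))).sub
      (continuous_const.mul (continuous_const.sub ((hBc _).pow 2)))
  -- integrability (left-hand side)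
  have intA : ∀ i, Integrable (fun x => (x.2 i / m i * partialQ i f x -
      (clForceMatrix n *ᵥ x.1) i * partialP i f x) * gaussDensity B x) := by
    intro i
    refine Continuous.integrable_of_hasCompactSupport
      ((((hpm i).mul (hQc i)).sub ((hWc i).mul (hPc i))).mul hρc) ?_
    exact (((hQs i).mul_left (f := fun x : PhaseSpace n => x.2 i / m i)).sub
      ((hPs i).mul_left)).mul_right
  have intB : ∀ (i : Fin n) (c : Prop) [Decidable c] (Tb : ℝ), Integrable (fun x =>
      (if c then Tb * partialP i (partialP i f) x - x.2 i * partialP i f x else 0) *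
        gaussDensity B x) := by
    intro i c _ Tb
    by_cases hc : c
    · simp only [hc, if_true]
      refine Continuous.integrable_of_hasCompactSupport
        (((continuous_const.mul (hPPc i)).sub ((hp2 i).mul (hPc i))).mul hρc) ?_
      exact (((hPPs i).mul_left).sub ((hPs i).mul_left)).mul_right
    · simp only [hc, if_false, zero_mul]
      exact integrable_zero _ _ _
  have intBC : ∀ i : Fin n, Integrable (fun x =>
      (if i.val = 0 then T_L * m i * partialP i (partialP i f) x - x.2 i * partialP i f x else 0) *
          gaussDensity B x +
        (if i.val = n - 1 then T_R * m i * partialP i (partialP i f) x - x.2 i * partialP i f x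
          else 0) * gaussDensity B x) :=
    fun i => (intB i _ (T_L * m i)).add (intB i _ (T_R * m i))
  -- integrability (right-hand side)
  have intA' : ∀ i, Integrable (fun x => liou i x * gaussDensity B x * f x) := fun i =>
    (((hliou_c i).mul hρc).mul hf.continuous).integrable_of_hasCompactSupport hfc.mul_left
  have intB2 : ∀ (i : Fin n) (c : Prop) [Decidable c] (Tb : ℝ), Integrable (fun x =>
      (if c then bath Tb i x else 0) * gaussDensity B x * f x) := by
    intro i c _ Tb
    by_cases hc : c
    · simp only [hc, if_true]
      exact (((hbath_c Tb i).mul hρc).mul hf.continuous).integrable_of_hasCompactSupport hfc.mul_left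
    · simp only [hc, if_false, zero_mul]
      exact integrable_zero _ _ _
  have intBC' : ∀ i : Fin n, Integrable (fun x =>
      (if i.val = 0 then bath (T_L * m i) i x else 0) * gaussDensity B x * f x +
        (if i.val = n - 1 then bath (T_R * m i) i x else 0) * gaussDensity B x * f x) :=
    fun i => (intB2 i _ (T_L * m i)).add (intB2 i _ (T_R * m i))
  -- values of the bath terms (the tree's bath lemma with `T_b = T m_i`)
  have valB : ∀ (i : Fin n) (c : Prop) [Decidable c] (Tb : ℝ), ∫ x,
      (if c then Tb * partialP i (partialP i f) x - x.2 i * partialP i f x else 0) *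
        gaussDensity B x = ∫ x, (if c then bath Tb i x else 0) * gaussDensity B x * f x := by
    intro i c _ Tb
    by_cases hc : c
    · simp only [hc, if_true]
      exact OscillatorChain.integral_bath_mul_gaussDensity B hB Tb hf hfc i
    · simp only [hc, if_false, zero_mul, integral_zero]
  -- pointwise splitting of the integrands
  have hsplit : (fun x => clGenerator m lam T_L T_R f x * gaussDensity B x) = fun x =>
      (∑ i : Fin n, (x.2 i / m i * partialQ i f x - (clForceMatrix n *ᵥ x.1) i * partialP i f x) *
        gaussDensity B x) +
      lam * ∑ i : Fin n,
        ((if i.val = 0 then T_L * m i * partialP i (partialP i f) x - x.2 i * partialP i f x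
            else 0) * gaussDensity B x +
          (if i.val = n - 1 then T_R * m i * partialP i (partialP i f) x - x.2 i * partialP i f x
            else 0) * gaussDensity B x) := by
    funext x
    rw [hgen x]
    simp only [add_mul, Finset.sum_mul, mul_assoc]
  have hsplit' : (fun x => clAdjointPoly B m lam T_L T_R x * gaussDensity B x * f x) = fun x =>
      (∑ i : Fin n, liou i x * gaussDensity B x * f x) +
      lam * ∑ i : Fin n,
        ((if i.val = 0 then bath (T_L * m i) i x else 0) * gaussDensity B x * f x +
          (if i.val = n - 1 then bath (T_R * m i) i x else 0) * gaussDensity B x * f x) := by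
    funext x
    simp only [clAdjointPoly, hliou, hbath, add_mul, Finset.sum_mul, mul_assoc]
  -- per-site values of the bath sums
  have hLi : ∀ i : Fin n, ∫ x,
      ((if i.val = 0 then T_L * m i * partialP i (partialP i f) x - x.2 i * partialP i f x
          else 0) * gaussDensity B x +
        (if i.val = n - 1 then T_R * m i * partialP i (partialP i f) x - x.2 i * partialP i f x
          else 0) * gaussDensity B x) =
      (∫ x, (if i.val = 0 then bath (T_L * m i) i x else 0) * gaussDensity B x * f x) +
        ∫ x, (if i.val = n - 1 then bath (T_R * m i) i x else 0) * gaussDensity B x * f x := by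
    intro i
    rw [integral_add (intB i _ (T_L * m i)) (intB i _ (T_R * m i)), valB, valB]
  have hRi : ∀ i : Fin n, ∫ x,
      ((if i.val = 0 then bath (T_L * m i) i x else 0) * gaussDensity B x * f x +
        (if i.val = n - 1 then bath (T_R * m i) i x else 0) * gaussDensity B x * f x) =
      (∫ x, (if i.val = 0 then bath (T_L * m i) i x else 0) * gaussDensity B x * f x) +
        ∫ x, (if i.val = n - 1 then bath (T_R * m i) i x else 0) * gaussDensity B x * f x :=
    fun i => integral_add (intB2 i _ (T_L * m i)) (intB2 i _ (T_R * m i))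
  have hL : ∫ x, clGenerator m lam T_L T_R f x * gaussDensity B x =
      (∑ i : Fin n, ∫ x, liou i x * gaussDensity B x * f x) +
      lam * ∑ i : Fin n, ((∫ x, (if i.val = 0 then bath (T_L * m i) i x else 0) *
          gaussDensity B x * f x) +
        ∫ x, (if i.val = n - 1 then bath (T_R * m i) i x else 0) * gaussDensity B x * f x) := by
    rw [hsplit, integral_add (integrable_finsetSum _ fun i _ => intA i)
      ((integrable_finsetSum _ fun i _ => intBC i).const_mul _), integral_const_mul,
      integral_finsetSum _ fun i _ => intA i, integral_finsetSum _ fun i _ => intBC i]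
    congr 1
    · exact Finset.sum_congr rfl fun i _ =>
        cl_integral_liouville_mul_gaussDensity B hB m hf1 hfc i
    · congr 1
      exact Finset.sum_congr rfl fun i _ => hLi i
  have hR : ∫ x, clAdjointPoly B m lam T_L T_R x * gaussDensity B x * f x =
      (∑ i : Fin n, ∫ x, liou i x * gaussDensity B x * f x) +
      lam * ∑ i : Fin n, ((∫ x, (if i.val = 0 then bath (T_L * m i) i x else 0) *
          gaussDensity B x * f x) +
        ∫ x, (if i.val = n - 1 then bath (T_R * m i) i x else 0) * gaussDensity B x * f x) := by
    rw [hsplit', integral_add (integrable_finsetSum _ fun i _ => intA' i)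
      ((integrable_finsetSum _ fun i _ => intBC' i).const_mul _), integral_const_mul,
      integral_finsetSum _ fun i _ => intA' i, integral_finsetSum _ fun i _ => intBC' i]
    congr 1
    congr 1
    exact Finset.sum_congr rfl fun i _ => hRi i
  rw [hL, hR]

end Literature.Barriers.AtomisticToContinuum.HeatConduction

end
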